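import Literature.NumberTheory.GaloisCohomology.PoitouTateOddPrimePower
import HarnessLib

/-!
# The reciprocity law `∑_v inv_v = 0` on `H²(Γ_K, μ_n)` for every ODD `n`, over ANY number field

Primary decomposition at odd levels without the totally-complex hypothesis: the reduction
`sumInvLocalizationEqZero_canonical_of_coprime` / `…_of_primePow` of `PoitouTatePrimaryReduction.lean`
used `IsTotallyComplex K` only to kill the archimedean members of the canonical family; at ODD levels
they vanish over every number field (`LocalInvariants.canonical_inl_eq_zero_of_odd`,
`H²(Gal(ℂ/ℝ), μ_n) = 0` for `n` odd).  Combined with the odd prime-power case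
`sumInvLocalizationEqZero_canonical_primePow_of_odd_or_isTotallyComplex` (`PoitouTateOddPrimePower.lean`):

* `sumInvLocalizationEqZero_canonical_of_coprime_of_odd`, `sumInvLocalizationEqZero_canonical_of_primePow_of_odd`
  — the reduction at odd levels;
* `sumInvLocalizationEqZero_canonical_of_odd` — **`(LocalInvariants.canonical K n).SumInvLocalizationEqZero`
  for every number field `K` and every odd `n ≥ 1`**: the canonical local invariant maps are a family
  along which the invariants of every class in `H²(Γ_K, μ_n)` sum to zero (Tate, Cassels–Fröhlich VII
  §9.6/§11; Milne ADT I 4.10).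

The even levels over fields with real places remain (the `2`-primary killing at real places).
Theorems only (D-0026).

## References

* J. Tate, *Global class field theory*, Ch. VII of Cassels–Fröhlich (1967), §11. [CasselsFrohlich1967]
* J. S. Milne, *Arithmetic Duality Theorems* (2006), Ch. I Thm. 4.10. [MilneADT2006]
-/

noncomputable section

open CategoryTheory Function Field NumberField IsDedekindDomain
open scoped NumberField

namespace Literature.NumberTheory.GaloisCohomology

open _root_.ContinuousCohomology
open Literature.NumberTheory.GaloisRepresentations
open Literature.NumberTheory.GaloisRepresentations.DiscreteGaloisModule
open Literature.AnabelianGeometry.AbsoluteAnabelian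
open Literature.AnabelianGeometry.AbsoluteAnabelian.Prop121vii

section Reduction

variable {K : Type} [Field K] [NumberField K]

/-- **The reciprocity law for the canonical family at an ODD level `a·b` from the levels `a`, `b`
(`a`, `b` coprime)**, any number field: the proof of `sumInvLocalizationEqZero_canonical_of_coprime`
(Bezout decomposition `c = e·(a·c) + f·(b·c)`, level-change formulas for the invariants) with the
archimedean terms killed by oddness (`LocalInvariants.canonical_inl_eq_zero_of_odd`) instead of
total complexity. [cite: CasselsFrohlich1967, Ch. VII §11] -/
theorem sumInvLocalizationEqZero_canonical_of_coprime_of_odd {a b n : ℕ} [NeZero a]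
    [NeZero b] [NeZero n] (hodd : Odd n) (hn : a * b = n) (hab : a.Coprime b)
    (ha : (LocalInvariants.canonical K a).SumInvLocalizationEqZero)
    (hb : (LocalInvariants.canonical K b).SumInvLocalizationEqZero) :
    (LocalInvariants.canonical K n).SumInvLocalizationEqZero := by
  haveI : CompactSpace (absoluteGaloisGroup K) := absoluteGaloisGroup_compactSpace K
  intro c S hS
  have hao : Odd a := hodd.of_dvd_nat (Dvd.intro b hn)
  have hbo : Odd b := hodd.of_dvd_nat (Dvd.intro_left a hn)
  have hn' : b * a = n := by rw [mul_comm, hn]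
  -- Bezout
  obtain ⟨e, f, hef⟩ := Nat.isCoprime_iff_coprime.2 hab
  -- the embeddings `ℤ/m ↪ ℤ/n`, `k ↦ k·(n/m)`, as additive maps
  have hΨ : ∀ {m d : ℕ} [NeZero m], m * d = n →
      ∃ Ψ : ZMod m →+ ZMod n, ∀ k : ZMod m, Ψ k = ((k.val * d : ℕ) : ZMod n) := by
    intro m d _ hmd
    refine ⟨ZMod.lift m ⟨zmultiplesHom (ZMod n) (d : ZMod n), ?_⟩, fun k => ?_⟩
    · rw [zmultiplesHom_apply, natCast_zsmul, nsmul_eq_mul, ← Nat.cast_mul, hmd, ZMod.natCast_self]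
    · have hk : ((k.val : ℤ) : ZMod m) = k := by rw [Int.cast_natCast, ZMod.natCast_zmod_val]
      conv_lhs => rw [← hk]
      rw [ZMod.lift_coe]
      change ((k.val : ℕ) : ℤ) • (d : ZMod n) = _
      rw [natCast_zsmul, nsmul_eq_mul, Nat.cast_mul]
  obtain ⟨Ψb, hΨb⟩ := hΨ hn'
  obtain ⟨Ψa, hΨa⟩ := hΨ hn
  -- the two pieces `y_a = H²(μ_n ↠ μ_a) c`, `y_b = H²(μ_n ↠ μ_b) c`
  set ya : galoisCohomology (mu K a) 2 := cohomologyMap (muPowHom K n a b hn) 2 c with hya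
  set yb : galoisCohomology (mu K b) 2 := cohomologyMap (muPowHom K n b a hn') 2 c with hyb
  have hbc : (b : ℤ) • c = cohomologyMap (muInclHom K (Dvd.intro b hn)) 2 ya := by
    rw [hya, natCast_zsmul]
    exact (cohomologyMap_muInclHom_muPowHom K hn c).symm
  have hac : (a : ℤ) • c = cohomologyMap (muInclHom K (Dvd.intro a hn')) 2 yb := by
    rw [hyb, natCast_zsmul]
    exact (cohomologyMap_muInclHom_muPowHom K hn' c).symm
  have hNa : n / b = a := by rw [← hn', Nat.mul_div_cancel_left a (NeZero.pos b)]
  have hNb : n / a = b := by rw [← hn, Nat.mul_div_cancel_left b (NeZero.pos a)]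
  -- the local terms, place by place
  have key : ∀ v : Place K,
      LocalInvariants.canonical K n v (galoisCohomology.localization (mu K n) v 2 c) =
        e • Ψb (LocalInvariants.canonical K b v
            (galoisCohomology.localization (mu K b) v 2 yb)) +
          f • Ψa (LocalInvariants.canonical K a v
            (galoisCohomology.localization (mu K a) v 2 ya)) := by
    intro v
    rcases v with w | v
    · rw [LocalInvariants.canonical_inl_eq_zero_of_odd hodd w,
        LocalInvariants.canonical_inl_eq_zero_of_odd hbo w,
        LocalInvariants.canonical_inl_eq_zero_of_odd hao w,
        map_zero, map_zero, smul_zero, smul_zero, add_zero]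
    · -- the invariant at `v` as an additive function of the global class
      set Φ : galoisCohomology (mu K n) 2 →+ ZMod n :=
        (LocalInvariants.canonical K n (Sum.inr v)).comp
          (galoisCohomology.localization (mu K n) (Sum.inr v) 2) with hΦ
      have hΦc : Φ c = e • Φ ((a : ℤ) • c) + f • Φ ((b : ℤ) • c) := by
        rw [map_zsmul, map_zsmul, smul_smul, smul_smul, ← add_smul, hef, one_smul]
      change Φ c = _
      rw [hΦc, hac, hbc, hΦ, AddMonoidHom.comp_apply, AddMonoidHom.comp_apply,
        LocalInvariants.canonical_inr, LocalInvariants.canonical_inr, LocalInvariants.canonical_inr,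
        localInvariantMap_localization_cohomologyMap_muInclHom,
        localInvariantMap_localization_cohomologyMap_muInclHom, hΨb, hΨa, hNa, hNb]
  -- the pieces have vanishing invariants outside `S`
  have hSb : ∀ v ∉ S, LocalInvariants.canonical K b v
      (galoisCohomology.localization (mu K b) v 2 yb) = 0 := by
    intro v hv
    rcases v with w | v
    · exact LocalInvariants.canonical_inl_eq_zero_of_odd hbo w _
    · rw [LocalInvariants.canonical_inr, hyb, localInvariantMap_localization_cohomologyMap_muPowHom,
        ← LocalInvariants.canonical_inr, hS _ hv, map_zero]
  have hSa : ∀ v ∉ S, LocalInvariants.canonical K a v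
      (galoisCohomology.localization (mu K a) v 2 ya) = 0 := by
    intro v hv
    rcases v with w | v
    · exact LocalInvariants.canonical_inl_eq_zero_of_odd hao w _
    · rw [LocalInvariants.canonical_inr, hya, localInvariantMap_localization_cohomologyMap_muPowHom,
        ← LocalInvariants.canonical_inr, hS _ hv, map_zero]
  -- sum up
  rw [Finset.sum_congr rfl fun v _ => key v, Finset.sum_add_distrib, ← Finset.smul_sum,
    ← Finset.smul_sum, ← map_sum, ← map_sum, hb yb S hSb, ha ya S hSa, map_zero, map_zero,
    smul_zero, smul_zero, add_zero]


/-- **Reduction of the reciprocity law at ODD levels to odd prime-power levels**, any number field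
(strong induction splitting off one prime-power factor, `sumInvLocalizationEqZero_canonical_of_coprime_of_odd`).
[cite: CasselsFrohlich1967, Ch. VII §11] -/
theorem sumInvLocalizationEqZero_canonical_of_primePow_of_odd
    (h : ∀ (q : ℕ) [NeZero q], IsPrimePow q → Odd q → (LocalInvariants.canonical K q).SumInvLocalizationEqZero)
    (n : ℕ) [NeZero n] (hno : Odd n) : (LocalInvariants.canonical K n).SumInvLocalizationEqZero := by
  -- strong induction on the level, generalising the `NeZero` instance
  have main : ∀ (m : ℕ) (_ : NeZero m), Odd m → (LocalInvariants.canonical K m).SumInvLocalizationEqZero := by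
    intro m
    induction m using Nat.strong_induction_on with
    | _ m ih =>
      intro _ hmo
      rcases Nat.lt_or_ge 1 m with hm1 | hm1
      swap
      · -- `m = 1`: `ℤ/1` is trivial
        have hm : m = 1 := le_antisymm hm1 (NeZero.pos m)
        subst hm
        intro c S _
        exact Subsingleton.elim _ _
      -- split off the `p`-primary part of `m` for a prime `p ∣ m`
      obtain ⟨p, hp, hpm⟩ := Nat.exists_prime_and_dvd (ne_of_gt hm1)
      have hm0 : m ≠ 0 := NeZero.ne m
      have habm : ordProj[p] m * ordCompl[p] m = m := Nat.ordProj_mul_ordCompl_eq_self m p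
      have hab : (ordProj[p] m).Coprime (ordCompl[p] m) := (Nat.coprime_ordCompl hp hm0).pow_left _
      have hk : 0 < m.factorization p := Nat.Prime.factorization_pos_of_dvd hp hm0 hpm
      haveI : NeZero (ordProj[p] m) := ⟨pow_ne_zero _ hp.ne_zero⟩
      have hb0 : 0 < ordCompl[p] m := Nat.ordCompl_pos p hm0
      haveI hb : NeZero (ordCompl[p] m) := ⟨hb0.ne'⟩
      have ha1 : 1 < ordProj[p] m := Nat.one_lt_pow hk.ne' hp.one_lt
      have hbm : ordCompl[p] m < m := by
        calc ordCompl[p] m = 1 * ordCompl[p] m := (one_mul _).symm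
          _ < ordProj[p] m * ordCompl[p] m := Nat.mul_lt_mul_of_pos_right ha1 hb0
          _ = m := habm
      have hao : Odd (ordProj[p] m) := hmo.of_dvd_nat (Dvd.intro _ habm)
      have hbo : Odd (ordCompl[p] m) := hmo.of_dvd_nat (Dvd.intro_left _ habm)
      exact sumInvLocalizationEqZero_canonical_of_coprime_of_odd hmo habm hab
        (h (ordProj[p] m) ⟨p, m.factorization p, hp.prime, hk, rfl⟩ hao) (ih _ hbm hb hbo)
  exact main n inferInstance hno

end Reduction

/-- **The reciprocity law `∑_v inv_v = 0` on `H²(Γ_K, μ_n)` for every number field `K` and every ODD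
`n ≥ 1`**, for the canonical family of local invariant maps (Tate, Cassels–Fröhlich VII §9.6/§11;
Milne, ADT I Thm. 4.10): odd prime-power levels by
`sumInvLocalizationEqZero_canonical_primePow_of_odd_or_isTotallyComplex` (cyclotomic killing, cyclic
surjectivity, Tate's correction above `p`, the cyclic reciprocity law with the archimedean
hypothesis discharged by oddness), assembled by `sumInvLocalizationEqZero_canonical_of_primePow_of_odd`.
[cite: CasselsFrohlich1967, Ch. VII §11] [cite: MilneADT2006, Ch. I, Thm. 4.10] -/
theorem sumInvLocalizationEqZero_canonical_of_odd (K : Type) [Field K] [NumberField K]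
    (n : ℕ) [NeZero n] (hn : Odd n) : (LocalInvariants.canonical K n).SumInvLocalizationEqZero := by
  refine sumInvLocalizationEqZero_canonical_of_primePow_of_odd (fun q _ hq hqo => ?_) n hn
  obtain ⟨p, k, hpq, hk, rfl⟩ := hq
  have hpp : p.Prime := Nat.prime_iff.mpr hpq
  haveI : Fact p.Prime := ⟨hpp⟩
  obtain ⟨m, rfl⟩ : ∃ m, k = m + 1 := ⟨k - 1, by omega⟩
  have hp2 : p ≠ 2 := by
    rintro rfl
    exact (Nat.not_even_iff_odd.mpr hqo) ((even_two).pow_of_ne_zero (by omega))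
  exact sumInvLocalizationEqZero_canonical_primePow_of_odd_or_isTotallyComplex K p (Or.inl hp2) m

end Literature.NumberTheory.GaloisCohomology

end
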